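import Literature.NumberTheory.EllipticCurves.Kato2004.LocalIwasawaCohomology
import Literature.NumberTheory.EllipticCurves.Kato2004.IwasawaH1ReductionKernel
import Literature.NumberTheory.EllipticCurves.GaloisActionProofs
import Mathlib.GroupTheory.Index
import Mathlib.RingTheory.Finiteness.Basic
import HarnessLib

/-!
# The `p`-torsion of Kato's local Iwasawa cohomology `𝐇¹_{loc,Γ}(T)` is FINITE — in particular
# `#𝐇¹_{loc,Γ}(T_pW)[p] ≤ #W[p]` for the Tate module of an elliptic curve, at every place and every prime

Topic `NumberTheory/EllipticCurves`, sub-directory `Kato2004` (namespace = path).  `Proofs`-style file: theorems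
only (no definition, no named fact, no `sorry`, no instance, no notation).  Cell `pub/bsd-2adic`, LEAD seat
`cruxlead-stmt-BirchSwinnertonDyer-19556` (g10; crux `OrdLambdaHalfAtTwo` = item stmt-BirchSwinnertonDyer-19556, line
`kato_determinant_greenberg_two`): the one new ingredient through which the line's print-bundle conjunct (12.2.3)
`Kato2004.localIwasawaH1_tateRep_moduleFinite` (`LocalIwasawaCohomologyFiniteness.lean`) becomes REDUNDANT inside the
Shapiro/Poitou–Tate supply (Summits side, `…LocalFiniteOfShapiroPT`): there `𝐇¹_loc ⧸ L ↪ X_Gr` (finitely generated)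
and `2·L ≤ range(loc) ≤ L` with `range(loc)` finitely generated by the KERNEL global (12.2.1)
(`IwasawaH1Data.module_finite_of_isCyclotomic`), so `𝐇¹_loc` is finitely generated as soon as its `2`-torsion is —
which is what this file proves, for every `p`.

## What is proved

* §1 (any topological ring `R`, topological group `G`, `X : TopRep R G`, `r ∈ R` acting injectively on `X`):
  **`ContinuousH1.exists_injective_of_smul_eq_zero`** — the classes `c ∈ H¹_cont(G, X)` with `r • c = 0` INJECT into
  `X ⧸ rX`: `r•[φ] = 0` means `r φ = ∂m`, and `[φ] ↦ m mod rX` is injective (if `m₁ − m₂ = r s` then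
  `r(φ₁ − φ₂ − ∂s) = 0`, so `φ₁ − φ₂ = ∂s`).  This is the piece `H⁰(X/rX) ↠ H¹(X)[r]` of the cohomology sequence of
  `0 → X →r X → X/r → 0`, on continuous cochains, with no long exact sequence invoked (compare the tree's levelwise
  `Kato2004.reduceH1_eq_zero_iff`, the piece `H¹(T)/p ↪ H¹(T/p)`).  Corollaries `…finite_of_smul_eq_zero`,
  `…natCard_le_of_smul_eq_zero`.
* §2 (any `ℤ_p`-extension datum `κ` of `ℚ`, any place `v`, any `γ`, any `p`-adic representation `T` of `Γ_{ℚ_v}` on `M`,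
  any pin `J : LocalIwasawaH1Data κ v T γ`): `proj` at a level determines `proj` at all lower levels
  (`proj_eq_of_proj_add_eq`), a finite set of elements of `𝐇¹_loc` is separated by ONE level (`exists_injOn_proj`), and
  **`LocalIwasawaH1Data.finite_setOf_natCast_smul_eq_zero`**: if `p` acts injectively on `M` and `M ⧸ pM` is finite then
  `{x ∈ 𝐇¹_loc | p•x = 0}` is finite, of cardinality `≤ #(M ⧸ pM)` (`ncard_setOf_natCast_smul_eq_zero_le`) — pigeonhole
  in the inverse system: `B + 1` torsion elements are separated at one level `N`, where they land in `H¹(ℚ_{N,v}, T)[p]`,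
  of cardinality `≤ B` by §1.
* §3 (the Tate module): `T_pW` has no `p`-torsion and `T_pW ⧸ p ↪ W[p]` is finite (tree: `TateModule.eq_of_prime_nsmul_eq`,
  `exists_prime_nsmul_eq_of_proj_one_eq_zero`, `finite_torsionPoints_holds`), hence
  **`LocalIwasawaH1Data.finite_setOf_natCast_smul_eq_zero_tateRep`**: for every elliptic `W/ℚ`, prime `p`, `κ`, `v`, `γᵥ`
  and pin `J : LocalIwasawaH1Data κ v ((tateRep W p).toLocal v) γᵥ`, the set `{x ∈ 𝐇¹_{loc,Γ}(T_pW) | p•x = 0}` is finite.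

HONEST FRAMING.  Elementary cocycle bookkeeping + a counting argument; nothing here is (12.2.3) itself (finite
generation of `𝐇¹_loc` over `Λ`), whose kernel road — the local twin of the tree's (14.14.1) chain
`Kato2004/IwasawaTwistTate*` + `IwasawaH1ProjZeroKernelProofs` on `LocalIwasawaH1Data`, plus the `ℤ_p`-finiteness of
`H¹(ℚ_v, T_pW)` — is not attempted.  In truth `𝐇¹_{loc,Γ}(T_pW)[p] = 0` (the transition maps of `(H¹(U_n,T)[p])_n`
are eventually the norm `= p` on `W[p]^{U_n}`); the bound `≤ #W[p]` is all the consumer needs.  Nothing about BSD.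

## References
* K. Kato, *p-adic Hodge theory and values of zeta functions of modular forms*, Astérisque 295 (2004), §12.2 (12.2.3)
  (p. 220), §13.8 (pp. 228–229). [Kato2004Asterisque]
* J.-P. Serre, *Galois Cohomology* (1997), I §2.2 (cochains, `H¹ = Z¹/B¹`), I §2.3 (exact sequences). [SerreGaloisCohomology1997]
* K. Rubin, *Euler Systems* (2000), App. B §2 (continuous cohomology of `lim T/p^n`). [Rubin2000]
* J. H. Silverman, *The Arithmetic of Elliptic Curves* (2009), III §7, Cor. III.6.4. [SilvermanAEC2009]
-/

noncomputable section

open scoped NumberField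
open Field CategoryTheory IsDedekindDomain
open Literature.NumberTheory.GaloisRepresentations
open Literature.NumberTheory.EllipticCurves Literature.NumberTheory.EllipticCurves.Kato2004
open Literature.NumberTheory.EllipticCurves.Kato2004.EulerSystemValues
open Literature.NumberTheory.EllipticCurves.CyclotomicLayer (layerGroup)
open WeierstrassCurve (geomPoints geomTorsion)

universe u v

/-! ## §1 `H¹_cont(G, X)[r] ↪ X ⧸ rX` for `r` acting injectively on `X` -/

namespace Literature.ContinuousH1

variable {R : Type u} [CommRing R] [TopologicalSpace R]
  {G : Type v} [Group G] [TopologicalSpace G] [IsTopologicalGroup G] (X : TopRep.{v} R G)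

/-- **The `r`-torsion of `H¹_cont(G, X)` injects into `X ⧸ rX`** when `r` acts injectively on `X`: writing
`r • [φ] = [r φ] = 0` as `r φ = ∂m` (`oneCocycleClass_eq_zero_iff`), the assignment `[φ] ↦ m mod rX` is injective —
if `m₁ − m₂ = r s` then `r (φ₁ g − φ₂ g − (g s − s)) = 0` for all `g`, so `φ₁ − φ₂ = ∂s`.  (The map `H⁰(G, X/rX) ↠ H¹(G, X)[r]`
of the cohomology sequence of `0 → X →r X → X/rX → 0`, read backwards on continuous cochains.)
[cite: SerreGaloisCohomology1997, I §2.2–§2.3] -/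
theorem exists_injective_of_smul_eq_zero (r : R) (hr : ∀ x : X, r • x = 0 → x = 0) :
    ∃ f : {c : continuousCohomology 1 X // r • c = 0} → X ⧸ LinearMap.range (LinearMap.lsmul R X r),
      Function.Injective f := by
  classical
  have hrep : ∀ c : {c : continuousCohomology 1 X // r • c = 0},
      ∃ φ : contOneCocycles X, ∃ m : X, oneCocycleClass X φ = c.1 ∧ ∀ g, r • φ.1 g = X.ρ g m - m := by
    rintro ⟨c, hc⟩
    obtain ⟨φ, rfl⟩ := oneCocycleClass_surjective X c
    rw [← oneCocycleClass_smul, oneCocycleClass_eq_zero_iff] at hc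
    obtain ⟨m, hm⟩ := hc
    refine ⟨φ, m, rfl, fun g => ?_⟩
    rw [← hm g, Submodule.coe_smul, ContinuousMap.smul_apply]
  choose φ m hφ hm using hrep
  refine ⟨fun c => Submodule.Quotient.mk (m c), fun c₁ c₂ h => ?_⟩
  have h' : m c₁ - m c₂ ∈ LinearMap.range (LinearMap.lsmul R X r) := (Submodule.Quotient.eq _).mp h
  obtain ⟨s, hs⟩ := h'
  rw [LinearMap.lsmul_apply] at hs
  apply Subtype.ext
  rw [← hφ c₁, ← hφ c₂, ← sub_eq_zero, ← oneCocycleClass_sub, oneCocycleClass_eq_zero_iff]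
  refine ⟨s, fun g => sub_eq_zero.mp (hr _ ?_)⟩
  rw [Submodule.coe_sub, ContinuousMap.sub_apply, smul_sub, smul_sub, hm c₁ g, hm c₂ g, smul_sub,
    ← (X.ρ g).map_smul r s, hs, map_sub]
  abel

/-- **`H¹_cont(G, X)[r]` is finite when `X ⧸ rX` is** (`r` acting injectively on `X`).
[cite: SerreGaloisCohomology1997, I §2.2–§2.3] -/
theorem finite_of_smul_eq_zero (r : R) (hr : ∀ x : X, r • x = 0 → x = 0)
    [Finite (X ⧸ LinearMap.range (LinearMap.lsmul R X r))] :
    Finite {c : continuousCohomology 1 X // r • c = 0} := by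
  obtain ⟨f, hf⟩ := exists_injective_of_smul_eq_zero X r hr
  exact Finite.of_injective f hf

/-- **`#H¹_cont(G, X)[r] ≤ #(X ⧸ rX)`** when `X ⧸ rX` is finite and `r` acts injectively on `X`.
[cite: SerreGaloisCohomology1997, I §2.2–§2.3] -/
theorem natCard_le_of_smul_eq_zero (r : R) (hr : ∀ x : X, r • x = 0 → x = 0)
    [Finite (X ⧸ LinearMap.range (LinearMap.lsmul R X r))] :
    Nat.card {c : continuousCohomology 1 X // r • c = 0} ≤
      Nat.card (X ⧸ LinearMap.range (LinearMap.lsmul R X r)) := by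
  obtain ⟨f, hf⟩ := exists_injective_of_smul_eq_zero X r hr
  exact Nat.card_le_card_of_injective f hf

end Literature.ContinuousH1

/-! ## §2 The `p`-torsion of a pinned `𝐇¹_{loc,Γ}(T)` is finite (pigeonhole in the inverse system) -/

namespace Literature.NumberTheory.EllipticCurves.Kato2004

namespace LocalIwasawaH1Data

variable {p : ℕ} [Fact p.Prime] {κ : ZpExtension ℚ p} {v : HeightOneSpectrum (𝓞 ℚ)}
  {M : Type} [AddCommGroup M] [Module ℤ_[p] M] [TopologicalSpace M] [IsTopologicalAddGroup M]
  [ContinuousSMul ℤ_[p] M] {T : GaloisRep (v.adicCompletion ℚ) ℤ_[p] M}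
  {γ : absoluteGaloisGroup (v.adicCompletion ℚ)} (J : LocalIwasawaH1Data κ v T γ)

/-- `proj` at level `n + k` determines `proj` at level `n` (iterate `cores_proj`).
[cite: Kato2004Asterisque, §12.2 (p. 220)] -/
theorem proj_eq_of_proj_add_eq {x y : J.H} (n : ℕ) :
    ∀ k : ℕ, J.proj (n + k) x = J.proj (n + k) y → J.proj n x = J.proj n y
  | 0, h => h
  | k + 1, h => proj_eq_of_proj_add_eq n k (by
      rw [← J.cores_proj (n + k) x, ← J.cores_proj (n + k) y]
      exact congrArg _ h)

/-- If two elements of `𝐇¹_loc` differ at level `n`, they differ at every level `m ≥ n`.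
[cite: Kato2004Asterisque, §12.2 (p. 220)] -/
theorem proj_ne_of_le {x y : J.H} {n m : ℕ} (hnm : n ≤ m) (h : J.proj n x ≠ J.proj n y) :
    J.proj m x ≠ J.proj m y := by
  obtain ⟨k, rfl⟩ := Nat.exists_eq_add_of_le hnm
  exact fun hm => h (J.proj_eq_of_proj_add_eq n k hm)

/-- Two distinct elements of `𝐇¹_loc` differ at some level (`proj_injective`).
[cite: Kato2004Asterisque, §12.2 (p. 220)] -/
theorem exists_proj_ne_of_ne {x y : J.H} (h : x ≠ y) : ∃ n, J.proj n x ≠ J.proj n y := by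
  by_contra! H
  exact h (J.ext_of_proj H)

/-- **A finite set of elements of `𝐇¹_loc` is separated by one level**: there is `N` with `proj N` injective on it.
[cite: Kato2004Asterisque, §12.2 (p. 220)] -/
theorem exists_injOn_proj (t : Finset J.H) : ∃ N : ℕ, Set.InjOn (J.proj N) (t : Set J.H) := by
  classical
  have hsep : ∀ x y : J.H, ∃ n, x ≠ y → J.proj n x ≠ J.proj n y := fun x y => by
    by_cases hxy : x = y
    · exact ⟨0, fun h => absurd hxy h⟩
    · obtain ⟨n, hn⟩ := J.exists_proj_ne_of_ne hxy
      exact ⟨n, fun _ => hn⟩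
  let lvl : J.H → J.H → ℕ := fun x y => Nat.find (hsep x y)
  refine ⟨t.sup fun x => t.sup fun y => lvl x y, fun x hx y hy hxy => ?_⟩
  by_contra hne
  have hl : J.proj (lvl x y) x ≠ J.proj (lvl x y) y := Nat.find_spec (hsep x y) hne
  have hle : lvl x y ≤ t.sup fun x => t.sup fun y => lvl x y :=
    le_trans (Finset.le_sup (f := fun y => lvl x y) hy)
      (Finset.le_sup (f := fun x => t.sup fun y => lvl x y) hx)
  exact J.proj_ne_of_le hle hl hxy

/-- `p • x = 0` in `𝐇¹_loc` gives `p • proj n x = 0` at every level (constants act through `ℤ_p`, `proj_C_smul`).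
[cite: Kato2004Asterisque, §12.2 (p. 220)] -/
theorem smul_proj_eq_zero_of_natCast_smul_eq_zero {x : J.H} (hx : (p : IwasawaAlgebra p) • x = 0) (n : ℕ) :
    (p : ℤ_[p]) • J.proj n x = 0 := by
  have h := congrArg (J.proj n) hx
  rwa [map_zero, ← map_natCast (PowerSeries.C (R := ℤ_[p])) p, J.proj_C_smul] at h

/-- **At most `#(M ⧸ pM)` elements of `𝐇¹_loc` are killed by `p`, finite set by finite set** (for `p` acting injectively
on `M` and `M ⧸ pM` finite): separate the finite set at one level `N` (`exists_injOn_proj`); there it lands injectively in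
`H¹(ℚ_{N,v}, T)[p]`, of cardinality `≤ #(M ⧸ pM)` (§1). [cite: Kato2004Asterisque, §12.2 (12.2.3) (p. 220)]
[cite: SerreGaloisCohomology1997, I §2.2–§2.3] -/
theorem finsetCard_le_of_natCast_smul_eq_zero (hM : ∀ m : M, (p : ℤ_[p]) • m = 0 → m = 0)
    (hq : Finite (M ⧸ LinearMap.range (LinearMap.lsmul ℤ_[p] M (p : ℤ_[p]))))
    (t : Finset J.H) (ht : ∀ x ∈ t, (p : IwasawaAlgebra p) • x = 0) :
    t.card ≤ Nat.card (M ⧸ LinearMap.range (LinearMap.lsmul ℤ_[p] M (p : ℤ_[p]))) := by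
  classical
  obtain ⟨N, hN⟩ := J.exists_injOn_proj t
  let X : TopRep ℤ_[p] (layerGroup κ v N) := subgroupRep T.toTopRep (layerGroup κ v N)
  have hr : ∀ x : X, (p : ℤ_[p]) • x = 0 → x = 0 := hM
  haveI : Finite (X ⧸ LinearMap.range (LinearMap.lsmul ℤ_[p] X (p : ℤ_[p]))) := hq
  haveI := Literature.ContinuousH1.finite_of_smul_eq_zero X (p : ℤ_[p]) hr
  let g : t → {c : continuousCohomology 1 X // (p : ℤ_[p]) • c = 0} :=
    fun x => ⟨J.proj N x, J.smul_proj_eq_zero_of_natCast_smul_eq_zero (ht x x.2) N⟩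
  have hg : Function.Injective g := by
    rintro ⟨x, hx⟩ ⟨y, hy⟩ h
    exact Subtype.ext (hN hx hy (congrArg Subtype.val h))
  calc t.card = Nat.card t := (Nat.card_eq_finsetCard t).symm
    _ ≤ Nat.card {c : continuousCohomology 1 X // (p : ℤ_[p]) • c = 0} := Nat.card_le_card_of_injective g hg
    _ ≤ _ := Literature.ContinuousH1.natCard_le_of_smul_eq_zero X (p : ℤ_[p]) hr

/-- **The `p`-torsion of `𝐇¹_{loc,Γ}(T)` is a finite set** (for `p` acting injectively on `M` and `M ⧸ pM` finite).
[cite: Kato2004Asterisque, §12.2 (12.2.3) (p. 220)] [cite: SerreGaloisCohomology1997, I §2.2–§2.3] -/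
theorem finite_setOf_natCast_smul_eq_zero (hM : ∀ m : M, (p : ℤ_[p]) • m = 0 → m = 0)
    (hq : Finite (M ⧸ LinearMap.range (LinearMap.lsmul ℤ_[p] M (p : ℤ_[p])))) :
    {x : J.H | (p : IwasawaAlgebra p) • x = 0}.Finite := by
  by_contra hinf
  obtain ⟨t, ht, hcard⟩ := Set.Infinite.exists_subset_card_eq hinf
    (Nat.card (M ⧸ LinearMap.range (LinearMap.lsmul ℤ_[p] M (p : ℤ_[p]))) + 1)
  have h := J.finsetCard_le_of_natCast_smul_eq_zero hM hq t fun x hx => ht hx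
  omega

/-- **`#{x ∈ 𝐇¹_{loc,Γ}(T) | p•x = 0} ≤ #(M ⧸ pM)`** (for `p` acting injectively on `M` and `M ⧸ pM` finite).
[cite: Kato2004Asterisque, §12.2 (12.2.3) (p. 220)] [cite: SerreGaloisCohomology1997, I §2.2–§2.3] -/
theorem ncard_setOf_natCast_smul_eq_zero_le (hM : ∀ m : M, (p : ℤ_[p]) • m = 0 → m = 0)
    (hq : Finite (M ⧸ LinearMap.range (LinearMap.lsmul ℤ_[p] M (p : ℤ_[p])))) :
    {x : J.H | (p : IwasawaAlgebra p) • x = 0}.ncard ≤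
      Nat.card (M ⧸ LinearMap.range (LinearMap.lsmul ℤ_[p] M (p : ℤ_[p]))) := by
  have hfin := J.finite_setOf_natCast_smul_eq_zero hM hq
  rw [Set.ncard_eq_toFinset_card _ hfin]
  exact J.finsetCard_le_of_natCast_smul_eq_zero hM hq hfin.toFinset fun x hx =>
    (Set.Finite.mem_toFinset hfin).mp hx

/-- **The submodule form**: every `Λ`-submodule of `𝐇¹_loc` killed by `p` is finite (hence finitely generated).
[cite: Kato2004Asterisque, §12.2 (12.2.3) (p. 220)] -/
theorem finite_of_le_setOf_natCast_smul_eq_zero (hM : ∀ m : M, (p : ℤ_[p]) • m = 0 → m = 0)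
    (hq : Finite (M ⧸ LinearMap.range (LinearMap.lsmul ℤ_[p] M (p : ℤ_[p]))))
    (N : Submodule (IwasawaAlgebra p) J.H) (hN : ∀ x ∈ N, (p : IwasawaAlgebra p) • x = 0) : Finite N :=
  ((J.finite_setOf_natCast_smul_eq_zero hM hq).subset fun x hx => hN x hx).to_subtype

end LocalIwasawaH1Data

/-! ## §3 The Tate module: `T_pW` has no `p`-torsion, `T_pW ⧸ p ↪ W[p]` is finite -/

section TateRep

variable (W : WeierstrassCurve ℚ) (p : ℕ) [Fact p.Prime]

/-- `p ∈ ℤ_p` acts injectively on `T_pW` (`TateModule.eq_zero_of_prime_nsmul_eq_zero`).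
[cite: SilvermanAEC2009, III §7] -/
theorem tateModule_eq_zero_of_natCast_smul_eq_zero (a : W.tateModule p) (h : (p : ℤ_[p]) • a = 0) : a = 0 :=
  TateModule.eq_zero_of_prime_nsmul_eq_zero (by rwa [Nat.cast_smul_eq_nsmul] at h)

variable [W.IsElliptic]

/-- **`T_pW ⧸ p·T_pW` is finite**: the kernel of `a ↦ a_1 ∈ W[p]` is `p·T_pW`
(`TateModule.exists_prime_nsmul_eq_of_proj_one_eq_zero`) and `W[p]` is finite (`finite_torsionPoints_holds`), so
`p·T_pW` has finite index. [cite: SilvermanAEC2009, III §7 and Cor. III.6.4] -/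
theorem finite_tateModule_quotient_natCast_smul :
    Finite (W.tateModule p ⧸ LinearMap.range (LinearMap.lsmul ℤ_[p] (W.tateModule p) (p : ℤ_[p]))) := by
  classical
  let π : W.tateModule p →+ geomPoints W := TateModule.proj p 1
  -- the range of `π` lies in the finite `W[p]`
  have hfinTors : (geomTorsion W ((p ^ 1 : ℕ) : ℤ) : Set (geomPoints W)).Finite := by
    haveI : Finite (geomTorsion W ((p ^ 1 : ℕ) : ℤ)) :=
      W.finite_torsionPoints_holds (AlgebraicClosure ℚ)
        (by exact_mod_cast (pow_ne_zero 1 (Fact.out : p.Prime).ne_zero))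
    exact Set.toFinite _
  have hrange : (π.range : Set (geomPoints W)).Finite :=
    hfinTors.subset (by rintro _ ⟨a, rfl⟩; exact W.proj_tateModule_mem_geomTorsion p 1 a)
  haveI : Finite π.range := hrange.to_subtype
  have hidx : π.ker.FiniteIndex := by
    refine ⟨?_⟩
    rw [AddSubgroup.index_ker]
    haveI : Nonempty π.range := ⟨0⟩
    exact Nat.card_pos.ne'
  -- `ker π ≤ p·T_pW`
  have hle : π.ker ≤ (LinearMap.range (LinearMap.lsmul ℤ_[p] (W.tateModule p) (p : ℤ_[p]))).toAddSubgroup := by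
    intro a ha
    obtain ⟨b, hb, -⟩ := TateModule.exists_prime_nsmul_eq_of_proj_one_eq_zero a ha
    refine ⟨b, ?_⟩
    rw [LinearMap.lsmul_apply, Nat.cast_smul_eq_nsmul, hb]
  haveI := AddSubgroup.finiteIndex_of_le hle
  exact AddSubgroup.finite_quotient_of_finiteIndex

variable [ContinuousSMul ℤ_[p] (W.tateModule p)] {κ : ZpExtension ℚ p} {v : HeightOneSpectrum (𝓞 ℚ)}
  {γᵥ : absoluteGaloisGroup (v.adicCompletion ℚ)}

/-- **The `p`-torsion of the pinned `𝐇¹_{loc,Γ}(T_pW)` is finite**, for every elliptic `W/ℚ`, every prime `p`, every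
`ℤ_p`-extension datum `κ` of `ℚ`, every place `v` and every `γᵥ` (§2 for the Tate module, §3 inputs).
[cite: Kato2004Asterisque, §12.2 (12.2.3) (p. 220)] [cite: SilvermanAEC2009, III §7] -/
theorem LocalIwasawaH1Data.finite_setOf_natCast_smul_eq_zero_tateRep
    (J : LocalIwasawaH1Data κ v ((tateRep W p).toLocal v) γᵥ) :
    {x : J.H | (p : IwasawaAlgebra p) • x = 0}.Finite :=
  J.finite_setOf_natCast_smul_eq_zero (tateModule_eq_zero_of_natCast_smul_eq_zero W p)
    (finite_tateModule_quotient_natCast_smul W p)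

/-- **Submodule form for the Tate module**: every `Λ`-submodule of `𝐇¹_{loc,Γ}(T_pW)` killed by `p` is finite.
[cite: Kato2004Asterisque, §12.2 (12.2.3) (p. 220)] [cite: SilvermanAEC2009, III §7] -/
theorem LocalIwasawaH1Data.finite_of_le_natCast_smul_eq_zero_tateRep
    (J : LocalIwasawaH1Data κ v ((tateRep W p).toLocal v) γᵥ)
    (N : Submodule (IwasawaAlgebra p) J.H) (hN : ∀ x ∈ N, (p : IwasawaAlgebra p) • x = 0) : Finite N :=
  J.finite_of_le_setOf_natCast_smul_eq_zero (tateModule_eq_zero_of_natCast_smul_eq_zero W p)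
    (finite_tateModule_quotient_natCast_smul W p) N hN

end TateRep

end Literature.NumberTheory.EllipticCurves.Kato2004

end
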